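import Mathlib
import HarnessLib
import Literature.NumberTheory.LFunctions.AFEOscillatoryLemma

/-!
# The oscillatory integrals `∫ u^{-s} e^{2πiνu} du` of the Hardy–Littlewood approximate
# functional equation (Titchmarsh §4.13)

Topic `Literature/NumberTheory/LFunctions`. Fourth file of a proof of Titchmarsh's Theorem 4.13
(the approximate functional equation with remainder `O(x^{-σ} log t)`). It supplies the estimates
and the evaluation of the integrals appearing in §4.13 of Titchmarsh, *The Theory of the Riemann
Zeta-Function*, 2nd ed.:

* the first-derivative bounds (Lemma 4.3 of the book, here
  `Literature/NumberTheory/LFunctions/AFEOscillatoryLemma.lean`) for `∫_a^b u^w e^{iλu} du` with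
  the amplitude/phase split `u^{Re w} · e^{i(λu + Im w · log u)}` and the monotone factor
  `q(u) = u^{Re w + 1}/(λu + Im w)`: `Literature.NumberTheory.LFunctions.AFE.norm_integral_cpow_mul_exp_le` (`0 < a`) and
  `Literature.NumberTheory.LFunctions.AFE.norm_integral_cpow_mul_exp_le₀` (interval `[0, b]`);
* the three applications of §4.13: the "far" terms
  `∫_a^b u^{-s-1} e^{±2πiνu} du = O(a^{-σ}/(2πνa ∓ t))` (`Literature.NumberTheory.LFunctions.AFE.norm_integral_far_pos_le`,
  `Literature.NumberTheory.LFunctions.AFE.norm_integral_far_neg_le`), the bound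
  `∫_0^x u^{1-s} e^{2πiνu} du = O(x^{2-σ}/(t - 2πνx))` and the integration by parts
  `∫_0^x u^{-s} e^{2πiνu} du = [u^{1-s} e^{2πiνu}/(1-s)]_0^x - (2πiν/(1-s)) ∫_0^x u^{1-s} e^{2πiνu} du`
  (`Literature.NumberTheory.LFunctions.AFE.norm_integral_near_head_le`);
* the complete integral: `∫_0^∞ u^{-s} e^{-ru} du = Γ(1-s) r^{s-1}` for `Re r > 0` (analytic
  continuation in `r` of Mathlib's `Complex.integral_cpow_mul_exp_neg_mul_Ioi`,
  `Literature.NumberTheory.LFunctions.AFE.integral_cpow_mul_exp_neg_mul_Ioi_complex`) and its boundary value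
  "`∫_0^∞ e^{2πiνu} u^{-s} du = Γ(1-s) (2πν/i)^{s-1}`" in the finite form
  `‖∫_0^N u^{-s} e^{iλu} du - Γ(1-s)(-iλ)^{s-1}‖ ≤ 4 N^{1-σ}/(λN - t)`
  (`Literature.NumberTheory.LFunctions.AFE.norm_integral_cpow_mul_exp_sub_Gamma_le`).

Throughout `s = σ + it` with `0 < σ < 1`, `t > 0`.

## References

* E. C. Titchmarsh, *The Theory of the Riemann Zeta-Function*, 2nd ed. (rev. D. R. Heath-Brown),
  Oxford 1986, §4.13 (proof of Theorem 4.13), Lemma 4.3.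
-/

noncomputable section

open Complex MeasureTheory Set Filter intervalIntegral
open scoped Real Topology

namespace Literature.NumberTheory.LFunctions.AFE

/-! ## Amplitude/phase form of `u^w e^{iλu}` -/

/-- For `u > 0`: `u^w = u^{Re w} · e^{i Im w log u}`. [folklore] -/
theorem ofReal_cpow_eq_rpow_mul_exp {u : ℝ} (hu : 0 < u) (w : ℂ) :
    (u : ℂ) ^ w = ((u ^ w.re : ℝ) : ℂ) * Complex.exp (((w.im * Real.log u : ℝ) : ℂ) * I) := by
  rw [cpow_def_of_ne_zero (ofReal_ne_zero.2 hu.ne'), ← ofReal_log hu.le, Real.rpow_def_of_pos hu,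
    Complex.ofReal_exp, ← Complex.exp_add]
  congr 1
  conv_lhs => rw [← Complex.re_add_im w]
  push_cast
  ring

/-- For `u > 0`: `u^w e^{iλu} = u^{Re w} · e^{i(λu + Im w log u)}` — the amplitude/phase split used
to apply the first-derivative test. [folklore] -/
theorem ofReal_cpow_mul_exp_eq {u : ℝ} (hu : 0 < u) (w : ℂ) (lam : ℝ) :
    (u : ℂ) ^ w * Complex.exp (((lam * u : ℝ) : ℂ) * I)
      = ((u ^ w.re : ℝ) : ℂ) * Complex.exp (((lam * u + w.im * Real.log u : ℝ) : ℂ) * I) := by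
  rw [ofReal_cpow_eq_rpow_mul_exp hu, mul_assoc, ← Complex.exp_add]
  congr 2
  push_cast; ring

/-- The phase `F(u) = λu + m log u` has `F'(u) = λ + m/u` (`u ≠ 0`). [folklore] -/
theorem hasDerivAt_phase {lam m u : ℝ} (hu : u ≠ 0) :
    HasDerivAt (fun v : ℝ => lam * v + m * Real.log v) (lam + m / u) u := by
  have h1 : HasDerivAt (fun v : ℝ => lam * v) lam u := by
    simpa using (hasDerivAt_id u).const_mul lam
  have h2 : HasDerivAt (fun v : ℝ => m * Real.log v) (m / u) u := by
    simpa [div_eq_mul_inv] using (Real.hasDerivAt_log hu).const_mul m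
  exact h1.add h2

/-- The monotone factor `q(u) = u^{p+1}/(λu + m)` has
`q'(u) = ((p+1) u^p (λu+m) - λ u^{p+1})/(λu+m)²` wherever `u ≠ 0`, `λu + m ≠ 0`. [folklore] -/
theorem hasDerivAt_powQ {p lam m u : ℝ} (hu : u ≠ 0) (hden : lam * u + m ≠ 0) :
    HasDerivAt (fun v : ℝ => v ^ (p + 1) / (lam * v + m))
      (((p + 1) * u ^ p * (lam * u + m) - lam * u ^ (p + 1)) / (lam * u + m) ^ 2) u := by
  have h1 : HasDerivAt (fun v : ℝ => v ^ (p + 1)) ((p + 1) * u ^ p) u := by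
    have := Real.hasDerivAt_rpow_const (p := p + 1) (Or.inl hu)
    simpa using this
  have h2 : HasDerivAt (fun v : ℝ => lam * v + m) lam u := by
    simpa using ((hasDerivAt_id u).const_mul lam).add_const m
  exact (h1.div h2 hden).congr_deriv (by ring)

/-- `q · F' = u^p`: `(u^{p+1}/(λu+m)) (λ + m/u) = u^p` for `u > 0`, `λu + m ≠ 0`. [folklore] -/
theorem powQ_mul_deriv_phase {p lam m u : ℝ} (hu : 0 < u) (hden : lam * u + m ≠ 0) :
    u ^ (p + 1) / (lam * u + m) * (lam + m / u) = u ^ p := by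
  rw [Real.rpow_add hu, Real.rpow_one]
  have hu' : u ≠ 0 := hu.ne'
  have e : lam + m / u = (lam * u + m) / u := by field_simp
  rw [e, div_mul_div_comm, mul_comm (lam * u + m) u, ← div_mul_div_comm, div_self hden, mul_one,
    mul_div_assoc, div_self hu', mul_one]

/-! ## The first-derivative test for `∫ u^w e^{iλu}` -/

/-- **Titchmarsh's Lemma 4.3 for `∫_a^b u^w e^{iλu} du`, `0 < a`**: with
`q(u) = u^{Re w + 1}/(λu + Im w)` (`= G/F'` for the amplitude `G = u^{Re w}` and the phase
`F = λu + Im w log u`), if `λu + Im w ≠ 0` on `[a, b]`, `q` is monotonic on `[a, b]` and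
`|q| ≤ M` there, then `‖∫_a^b u^w e^{iλu} du‖ ≤ 4M`. [cite: Titchmarsh1986, Lemma 4.3] -/
theorem norm_integral_cpow_mul_exp_le {a b : ℝ} (ha : 0 < a) (hab : a ≤ b) (w : ℂ) {lam M : ℝ}
    (hden : ∀ u ∈ Icc a b, lam * u + w.im ≠ 0)
    (hmono : MonotoneOn (fun u : ℝ => u ^ (w.re + 1) / (lam * u + w.im)) (Icc a b)
      ∨ AntitoneOn (fun u : ℝ => u ^ (w.re + 1) / (lam * u + w.im)) (Icc a b))
    (hM : ∀ u ∈ Icc a b, |u ^ (w.re + 1) / (lam * u + w.im)| ≤ M) :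
    ‖∫ u in a..b, (u : ℂ) ^ w * Complex.exp (((lam * u : ℝ) : ℂ) * I)‖ ≤ 4 * M := by
  set q : ℝ → ℝ := fun u => u ^ (w.re + 1) / (lam * u + w.im) with hq
  set q' : ℝ → ℝ := fun u =>
    ((w.re + 1) * u ^ w.re * (lam * u + w.im) - lam * u ^ (w.re + 1)) / (lam * u + w.im) ^ 2
    with hq'
  set F : ℝ → ℝ := fun u => lam * u + w.im * Real.log u with hF
  set F' : ℝ → ℝ := fun u => lam + w.im / u with hF'
  have hpos : ∀ u ∈ Icc a b, 0 < u := fun u hu => ha.trans_le hu.1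
  -- identify the integrand on `[a, b]`
  have hcongr : ∫ u in a..b, (u : ℂ) ^ w * Complex.exp (((lam * u : ℝ) : ℂ) * I)
      = ∫ u in a..b, ((q u * F' u : ℝ) : ℂ) * Complex.exp ((F u : ℂ) * I) := by
    apply intervalIntegral.integral_congr
    intro u hu
    rw [uIcc_of_le hab] at hu
    have hu0 := hpos u hu
    simp only [hq, hF, hF']
    rw [powQ_mul_deriv_phase hu0 (hden u hu), ofReal_cpow_mul_exp_eq hu0]
  rw [hcongr]
  -- continuity facts on `[a, b]`
  have hqc : ContinuousOn q (Icc a b) := by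
    apply ContinuousOn.div _ (by fun_prop) hden
    exact fun u hu => (Real.continuousAt_rpow_const u _ (Or.inl (hpos u hu).ne')).continuousWithinAt
  have hFc : ContinuousOn F (Icc a b) := by
    apply ContinuousOn.add (by fun_prop)
    exact continuousOn_const.mul (Real.continuousOn_log.mono fun u hu => (hpos u hu).ne')
  have hF'c : ContinuousOn F' (Icc a b) := by
    apply ContinuousOn.add continuousOn_const
    exact continuousOn_const.div continuousOn_id fun u hu => (hpos u hu).ne'
  have hq'c : ContinuousOn q' (Icc a b) := by
    have hr : ∀ p : ℝ, ContinuousOn (fun u : ℝ => u ^ p) (Icc a b) := fun p u hu =>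
      (Real.continuousAt_rpow_const u p (Or.inl (hpos u hu).ne')).continuousWithinAt
    apply ContinuousOn.div _ (by fun_prop) (fun u hu => pow_ne_zero 2 (hden u hu))
    exact ((continuousOn_const.mul (hr _)).mul (by fun_prop)).sub (continuousOn_const.mul (hr _))
  refine norm_integral_mul_exp_I_le hab (F := F) (F' := F') (q := q) (q' := q') (M := M)
    (fun u hu => hasDerivAt_phase (hpos u (Ioo_subset_Icc_self hu)).ne')
    (fun u hu => hasDerivAt_powQ (hpos u (Ioo_subset_Icc_self hu)).ne'
      (hden u (Ioo_subset_Icc_self hu)))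
    hqc (continuousOn_mul_exp_phase hqc hFc)
    ((hq'c.mono (by rw [uIcc_of_le hab])).intervalIntegrable)
    ?_ hmono hM
  -- integrability of the integrand: it is continuous on `[a, b]`
  apply ContinuousOn.intervalIntegrable
  rw [uIcc_of_le hab]
  exact (Complex.continuous_ofReal.comp_continuousOn (hqc.mul hF'c)).mul
    ((Complex.continuous_ofReal.comp_continuousOn hFc).mul continuousOn_const).cexp


/-- **Titchmarsh's Lemma 4.3 for `∫_0^b u^w e^{iλu} du`** (amplitude vanishing at `0`): if
`0 < Re w`, `λu + Im w ≠ 0` on `[0, b]` (in particular `Im w ≠ 0`), `q(u) = u^{Re w+1}/(λu + Im w)`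
is monotonic on `[0, b]` with `|q| ≤ M`, then `‖∫_0^b u^w e^{iλu} du‖ ≤ 4M` (the phase
`λu + Im w log u` is singular at `0`, but `q(0) = 0`). [cite: Titchmarsh1986, Lemma 4.3] -/
theorem norm_integral_cpow_mul_exp_le₀ {b : ℝ} (hb : 0 ≤ b) (w : ℂ) (hw : 0 < w.re) {lam M : ℝ}
    (hden : ∀ u ∈ Icc 0 b, lam * u + w.im ≠ 0)
    (hmono : MonotoneOn (fun u : ℝ => u ^ (w.re + 1) / (lam * u + w.im)) (Icc 0 b)
      ∨ AntitoneOn (fun u : ℝ => u ^ (w.re + 1) / (lam * u + w.im)) (Icc 0 b))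
    (hM : ∀ u ∈ Icc 0 b, |u ^ (w.re + 1) / (lam * u + w.im)| ≤ M) :
    ‖∫ u in (0 : ℝ)..b, (u : ℂ) ^ w * Complex.exp (((lam * u : ℝ) : ℂ) * I)‖ ≤ 4 * M := by
  set q : ℝ → ℝ := fun u => u ^ (w.re + 1) / (lam * u + w.im) with hq
  set q' : ℝ → ℝ := fun u =>
    ((w.re + 1) * u ^ w.re * (lam * u + w.im) - lam * u ^ (w.re + 1)) / (lam * u + w.im) ^ 2
    with hq'
  set F : ℝ → ℝ := fun u => lam * u + w.im * Real.log u with hF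
  set F' : ℝ → ℝ := fun u => lam + w.im / u with hF'
  have hw0 : w ≠ 0 := fun h => by rw [h] at hw; simp at hw
  have hw1 : w.re + 1 ≠ 0 := by linarith
  have hq0 : q 0 = 0 := by simp [hq, Real.zero_rpow hw1]
  -- the two integrands agree on `(0, b]`
  have hEq : EqOn (fun u : ℝ => (u : ℂ) ^ w * Complex.exp (((lam * u : ℝ) : ℂ) * I))
      (fun u => ((q u * F' u : ℝ) : ℂ) * Complex.exp ((F u : ℂ) * I)) (uIoc 0 b) := by
    intro u hu
    rw [uIoc_of_le hb] at hu
    simp only [hq, hF, hF']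
    rw [powQ_mul_deriv_phase hu.1 (hden u ⟨hu.1.le, hu.2⟩), ofReal_cpow_mul_exp_eq hu.1]
  have hcongr : ∫ u in (0 : ℝ)..b, (u : ℂ) ^ w * Complex.exp (((lam * u : ℝ) : ℂ) * I)
      = ∫ u in (0 : ℝ)..b, ((q u * F' u : ℝ) : ℂ) * Complex.exp ((F u : ℂ) * I) := by
    apply intervalIntegral.integral_congr
    intro u hu
    rw [uIcc_of_le hb] at hu
    rcases hu.1.eq_or_lt with h0 | hpos
    · subst h0
      simp [hq0, Complex.zero_cpow hw0]
    · exact hEq (show u ∈ uIoc 0 b by rw [uIoc_of_le hb]; exact ⟨hpos, hu.2⟩)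
  rw [hcongr]
  -- continuity facts on `[0, b]`
  have hr : ∀ p : ℝ, 0 ≤ p → ContinuousOn (fun u : ℝ => u ^ p) (Icc 0 b) := fun p hp u _ =>
    (Real.continuousAt_rpow_const u p (Or.inr hp)).continuousWithinAt
  have hqc : ContinuousOn q (Icc 0 b) :=
    ContinuousOn.div (hr _ (by linarith)) (by fun_prop) hden
  have hq'c : ContinuousOn q' (Icc 0 b) := by
    apply ContinuousOn.div _ (by fun_prop) (fun u hu => pow_ne_zero 2 (hden u hu))
    exact ((continuousOn_const.mul (hr _ hw.le)).mul (by fun_prop)).sub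
      (continuousOn_const.mul (hr _ (by linarith)))
  have hF'c : ContinuousOn F' (Ioc 0 b) := by
    apply ContinuousOn.add continuousOn_const
    exact continuousOn_const.div continuousOn_id fun u hu => hu.1.ne'
  have hFc : ContinuousOn F (Ioc 0 b) := by
    apply ContinuousOn.add (by fun_prop)
    exact continuousOn_const.mul (Real.continuousOn_log.mono fun u hu => hu.1.ne')
  -- continuity of `q e^{iF}` on `[0, b]` (at `0` because `q(0) = 0`)
  have hPc : ContinuousOn (fun u => (q u : ℂ) * Complex.exp ((F u : ℂ) * I)) (Icc 0 b) := by
    intro u hu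
    rcases hu.1.eq_or_lt with h0 | hpos
    · subst h0
      have hlim : Tendsto (fun v => (q v : ℂ) * Complex.exp ((F v : ℂ) * I)) (𝓝[Icc 0 b] 0)
          (𝓝 0) := by
        rw [tendsto_zero_iff_norm_tendsto_zero]
        have h1 : Tendsto (fun v => ‖q v‖) (𝓝[Icc 0 b] 0) (𝓝 ‖q 0‖) := (hqc 0 hu).norm
        rw [hq0, norm_zero] at h1
        refine h1.congr fun v => ?_
        rw [norm_mul, Complex.norm_exp_ofReal_mul_I, mul_one, Complex.norm_real]
      show ContinuousWithinAt _ _ _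
      rw [ContinuousWithinAt, hq0]
      simpa using hlim
    · have hIoc : Ioc 0 b ∈ 𝓝[Icc 0 b] u := by
        apply mem_nhdsWithin.2
        refine ⟨Ioi 0, isOpen_Ioi, hpos, fun v hv => ⟨hv.1, hv.2.2⟩⟩
      have h := continuousOn_mul_exp_phase (hqc.mono Ioc_subset_Icc_self) hFc u ⟨hpos, hu.2⟩
      exact h.mono_of_mem_nhdsWithin hIoc
  -- integrability of the integrand (continuous version on the closed interval, transported)
  have hGi : IntervalIntegrable (fun u => ((q u * F' u : ℝ) : ℂ) * Complex.exp ((F u : ℂ) * I))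
      volume 0 b := by
    apply IntervalIntegrable.congr hEq
    apply Continuous.intervalIntegrable
    exact (continuous_ofReal_cpow_const hw).mul (by fun_prop)
  exact norm_integral_mul_exp_I_le hb (F := F) (F' := F') (q := q) (q' := q') (M := M)
    (fun u hu => hasDerivAt_phase hu.1.ne')
    (fun u hu => hasDerivAt_powQ hu.1.ne' (hden u (Ioo_subset_Icc_self hu)))
    hqc hPc ((hq'c.mono (by rw [uIcc_of_le hb])).intervalIntegrable) hGi hmono hM

/-! ## The three estimates of §4.13 -/

/-- **The far terms, positive frequency**: for `0 < σ = Re s`, `t = Im s`, `0 < a ≤ b`, `ν > 0`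
with `2πνa > t`: `‖∫_a^b u^{-s-1} e^{2πiνu} du‖ ≤ 4 a^{-σ}/(2πνa - t)` (Lemma 4.3 with the
decreasing factor `u^{-σ}/(2πνu - t)`). [cite: Titchmarsh1986, §4.13 and Lemma 4.3] -/
theorem norm_integral_far_pos_le {s : ℂ} (hσ : 0 < s.re) {a b ν : ℝ} (ha : 0 < a) (hab : a ≤ b)
    (hν : 0 < ν) (hνa : s.im < 2 * π * ν * a) :
    ‖∫ u in a..b, (u : ℂ) ^ (-s - 1) * Complex.exp (((2 * π * ν * u : ℝ) : ℂ) * I)‖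
      ≤ 4 * (a ^ (-s.re) / (2 * π * ν * a - s.im)) := by
  have hre : (-s - 1).re + 1 = -s.re := by simp
  have him : (-s - 1).im = -s.im := by simp
  have hfun : (fun u : ℝ => u ^ ((-s - 1).re + 1) / (2 * π * ν * u + (-s - 1).im))
      = fun u => u ^ (-s.re) / (2 * π * ν * u - s.im) := by
    funext u; rw [hre, him]; ring_nf
  have hc : 0 < 2 * π * ν := by positivity
  have hdenpos : ∀ u ∈ Icc a b, 0 < 2 * π * ν * u - s.im := by
    intro u hu
    have := mul_le_mul_of_nonneg_left hu.1 hc.le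
    linarith
  -- `A(u) = u^{-σ}/(2πνu - t)` is positive and decreasing on `[a, b]`
  have hA : ∀ u ∈ Icc a b, ∀ v ∈ Icc a b, u ≤ v →
      v ^ (-s.re) / (2 * π * ν * v - s.im) ≤ u ^ (-s.re) / (2 * π * ν * u - s.im) := by
    intro u hu v hv huv
    have hu0 : 0 < u := ha.trans_le hu.1
    have := mul_le_mul_of_nonneg_left huv hc.le
    apply div_le_div₀ (Real.rpow_nonneg hu0.le _)
      (Real.rpow_le_rpow_of_nonpos hu0 huv (by linarith)) (hdenpos u hu) (by linarith)
  apply norm_integral_cpow_mul_exp_le ha hab (-s - 1) (lam := 2 * π * ν)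
  · intro u hu; rw [him]; exact (by linarith [hdenpos u hu] : 2 * π * ν * u + -s.im ≠ 0)
  · right; rw [hfun]; exact fun u hu v hv huv => hA u hu v hv huv
  · intro u hu
    rw [show u ^ ((-s - 1).re + 1) / (2 * π * ν * u + (-s - 1).im)
        = u ^ (-s.re) / (2 * π * ν * u - s.im) from congrFun hfun u]
    have hu0 : 0 < u := ha.trans_le hu.1
    rw [abs_of_nonneg (div_nonneg (Real.rpow_nonneg hu0.le _) (hdenpos u hu).le)]
    exact hA a (left_mem_Icc.2 hab) u hu hu.1

/-- **The far terms, negative frequency**: for `0 < σ`, `t ≥ 0`, `0 < a ≤ b`, `ν > 0`: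
`‖∫_a^b u^{-s-1} e^{-2πiνu} du‖ ≤ 4 a^{-σ}/(2πνa + t)` (Lemma 4.3 with the increasing factor
`-u^{-σ}/(2πνu + t)`). [cite: Titchmarsh1986, §4.13 and Lemma 4.3] -/
theorem norm_integral_far_neg_le {s : ℂ} (hσ : 0 < s.re) (ht : 0 ≤ s.im) {a b ν : ℝ} (ha : 0 < a)
    (hab : a ≤ b) (hν : 0 < ν) :
    ‖∫ u in a..b, (u : ℂ) ^ (-s - 1) * Complex.exp (((-(2 * π * ν) * u : ℝ) : ℂ) * I)‖
      ≤ 4 * (a ^ (-s.re) / (2 * π * ν * a + s.im)) := by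
  have hre : (-s - 1).re + 1 = -s.re := by simp
  have him : (-s - 1).im = -s.im := by simp
  have hfun : (fun u : ℝ => u ^ ((-s - 1).re + 1) / (-(2 * π * ν) * u + (-s - 1).im))
      = fun u => -(u ^ (-s.re) / (2 * π * ν * u + s.im)) := by
    funext u; rw [hre, him, ← div_neg]; ring_nf
  have hc : 0 < 2 * π * ν := by positivity
  have hdenpos : ∀ u ∈ Icc a b, 0 < 2 * π * ν * u + s.im := by
    intro u hu
    have := mul_pos hc (ha.trans_le hu.1)
    linarith
  have hA : ∀ u ∈ Icc a b, ∀ v ∈ Icc a b, u ≤ v →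
      v ^ (-s.re) / (2 * π * ν * v + s.im) ≤ u ^ (-s.re) / (2 * π * ν * u + s.im) := by
    intro u hu v hv huv
    have hu0 : 0 < u := ha.trans_le hu.1
    have := mul_le_mul_of_nonneg_left huv hc.le
    apply div_le_div₀ (Real.rpow_nonneg hu0.le _)
      (Real.rpow_le_rpow_of_nonpos hu0 huv (by linarith)) (hdenpos u hu) (by linarith)
  apply norm_integral_cpow_mul_exp_le ha hab (-s - 1) (lam := -(2 * π * ν))
  · intro u hu; rw [him]; exact (by linarith [hdenpos u hu] : -(2 * π * ν) * u + -s.im ≠ 0)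
  · left; rw [hfun]
    intro u hu v hv huv
    exact neg_le_neg (hA u hu v hv huv)
  · intro u hu
    rw [show u ^ ((-s - 1).re + 1) / (-(2 * π * ν) * u + (-s - 1).im)
        = -(u ^ (-s.re) / (2 * π * ν * u + s.im)) from congrFun hfun u]
    have hu0 : 0 < u := ha.trans_le hu.1
    rw [abs_neg, abs_of_nonneg (div_nonneg (Real.rpow_nonneg hu0.le _) (hdenpos u hu).le)]
    exact hA a (left_mem_Icc.2 hab) u hu hu.1

/-- **The head integral after one integration by parts**: for `0 < σ < 1`, `a ≥ 0`, `ν > 0` with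
`2πνa < t`: `‖∫_0^a u^{1-s} e^{2πiνu} du‖ ≤ 4 a^{2-σ}/(t - 2πνa)` (Lemma 4.3 on `[0, a]` with
the decreasing factor `u^{2-σ}/(2πνu - t)`, which vanishes at `0`).
[cite: Titchmarsh1986, §4.13 and Lemma 4.3] -/
theorem norm_integral_near_aux_le {s : ℂ} (hσ0 : 0 < s.re) (hσ1 : s.re < 1) {a ν : ℝ} (ha : 0 ≤ a)
    (hν : 0 < ν) (hνa : 2 * π * ν * a < s.im) :
    ‖∫ u in (0 : ℝ)..a, (u : ℂ) ^ (1 - s) * Complex.exp (((2 * π * ν * u : ℝ) : ℂ) * I)‖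
      ≤ 4 * (a ^ (2 - s.re) / (s.im - 2 * π * ν * a)) := by
  have hre : (1 - s).re + 1 = 2 - s.re := by simp; ring
  have hre' : (1 - s).re = 1 - s.re := by simp
  have him : (1 - s).im = -s.im := by simp
  have hfun : (fun u : ℝ => u ^ ((1 - s).re + 1) / (2 * π * ν * u + (1 - s).im))
      = fun u => -(u ^ (2 - s.re) / (s.im - 2 * π * ν * u)) := by
    funext u; rw [hre, him, ← div_neg]; ring_nf
  have hc : 0 < 2 * π * ν := by positivity
  have hdenpos : ∀ u ∈ Icc 0 a, 0 < s.im - 2 * π * ν * u := by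
    intro u hu
    have := mul_le_mul_of_nonneg_left hu.2 hc.le
    linarith
  -- `A(u) = u^{2-σ}/(t - 2πνu)` is nonnegative and increasing on `[0, a]`
  have hA : ∀ u ∈ Icc 0 a, ∀ v ∈ Icc 0 a, u ≤ v →
      u ^ (2 - s.re) / (s.im - 2 * π * ν * u) ≤ v ^ (2 - s.re) / (s.im - 2 * π * ν * v) := by
    intro u hu v hv huv
    have := mul_le_mul_of_nonneg_left huv hc.le
    apply div_le_div₀ (Real.rpow_nonneg hv.1 _)
      (Real.rpow_le_rpow hu.1 huv (by linarith)) (hdenpos v hv) (by linarith)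
  apply norm_integral_cpow_mul_exp_le₀ ha (1 - s) (by rw [hre']; linarith) (lam := 2 * π * ν)
  · intro u hu; rw [him]; exact (by linarith [hdenpos u hu] : 2 * π * ν * u + -s.im ≠ 0)
  · right; rw [hfun]
    intro u hu v hv huv
    exact neg_le_neg (hA u hu v hv huv)
  · intro u hu
    rw [show u ^ ((1 - s).re + 1) / (2 * π * ν * u + (1 - s).im)
        = -(u ^ (2 - s.re) / (s.im - 2 * π * ν * u)) from congrFun hfun u]
    rw [abs_neg, abs_of_nonneg (div_nonneg (Real.rpow_nonneg hu.1 _) (hdenpos u hu).le)]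
    exact hA u hu a (right_mem_Icc.2 ha) hu.2


/-- Derivative of `u ↦ u^w` along the real axis, `u > 0`: `w u^{w-1}`. [folklore] -/
theorem hasDerivAt_ofReal_cpow {u : ℝ} (hu : 0 < u) (w : ℂ) :
    HasDerivAt (fun v : ℝ => (v : ℂ) ^ w) (w * (u : ℂ) ^ (w - 1)) u := by
  have h := (Complex.hasStrictDerivAt_cpow_const (c := w)
    (Complex.ofReal_mem_slitPlane.2 hu)).hasDerivAt
  exact h.comp_ofReal

/-- **Integration by parts at the origin** (Titchmarsh §4.13):
`∫_0^a u^{-s} e^{2πiνu} du = a^{1-s} e^{2πiνa}/(1-s) - (2πiν/(1-s)) ∫_0^a u^{1-s} e^{2πiνu} du` for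
`Re s < 1` (both integrals converge absolutely at `0`). [cite: Titchmarsh1986, §4.13] -/
theorem integral_cpow_neg_mul_exp_eq {s : ℂ} (hσ1 : s.re < 1) {a : ℝ} (ha : 0 ≤ a) (ν : ℝ) :
    ∫ u in (0 : ℝ)..a, (u : ℂ) ^ (-s) * Complex.exp (((2 * π * ν * u : ℝ) : ℂ) * I)
      = (a : ℂ) ^ (1 - s) * Complex.exp (((2 * π * ν * a : ℝ) : ℂ) * I) / (1 - s)
        - (2 * π * ν * I / (1 - s)) *
          ∫ u in (0 : ℝ)..a, (u : ℂ) ^ (1 - s) * Complex.exp (((2 * π * ν * u : ℝ) : ℂ) * I) := by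
  have h1s : (1 - s) ≠ 0 := by
    intro h; have := congrArg Complex.re h; simp at this; linarith
  have hre1 : 0 < (1 - s).re := by simp; linarith
  set E : ℝ → ℂ := fun u => Complex.exp (((2 * π * ν * u : ℝ) : ℂ) * I) with hE
  set P : ℝ → ℂ := fun u => (u : ℂ) ^ (1 - s) * E u / (1 - s) with hP
  -- derivative of `P` on `(0, a)`
  have hEd : ∀ u : ℝ, HasDerivAt E (E u * (((2 * π * ν : ℝ) : ℂ) * I)) u := by
    intro u
    have hF : HasDerivAt (fun v : ℝ => 2 * π * ν * v) (2 * π * ν) u := by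
      simpa using (hasDerivAt_id u).const_mul (2 * π * ν)
    exact hasDerivAt_exp_phase hF
  have hPd : ∀ u ∈ Ioo (0 : ℝ) a, HasDerivAt P
      ((u : ℂ) ^ (-s) * E u + (2 * π * ν * I / (1 - s)) * ((u : ℂ) ^ (1 - s) * E u)) u := by
    intro u hu
    have h1 := hasDerivAt_ofReal_cpow hu.1 (1 - s)
    rw [show (1 : ℂ) - s - 1 = -s by ring] at h1
    have h2 := (h1.mul (hEd u)).div_const (1 - s)
    refine h2.congr_deriv ?_
    field_simp
    push_cast
    ring
  -- continuity of `P` on `[0, a]` and integrability of `P'`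
  have hPc : ContinuousOn P (Icc 0 a) := by
    apply Continuous.continuousOn
    exact ((continuous_ofReal_cpow_const hre1).mul (by fun_prop)).div_const _
  have hI1 : IntervalIntegrable (fun u : ℝ => (u : ℂ) ^ (-s) * E u) volume 0 a :=
    (intervalIntegral.intervalIntegrable_cpow' (by simp; linarith)).mul_continuousOn (by fun_prop)
  have hI2 : IntervalIntegrable (fun u : ℝ => (u : ℂ) ^ (1 - s) * E u) volume 0 a :=
    ((continuous_ofReal_cpow_const hre1).mul (by fun_prop)).intervalIntegrable _ _
  have hFTC : ∫ u in (0 : ℝ)..a,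
      ((u : ℂ) ^ (-s) * E u + (2 * π * ν * I / (1 - s)) * ((u : ℂ) ^ (1 - s) * E u))
      = P a - P 0 :=
    integral_eq_sub_of_hasDeriv_right_of_le ha hPc (fun u hu => (hPd u hu).hasDerivWithinAt)
      (hI1.add (hI2.const_mul _))
  have hP0 : P 0 = 0 := by
    simp [hP, Complex.zero_cpow h1s]
  rw [intervalIntegral.integral_add hI1 (hI2.const_mul _), intervalIntegral.integral_const_mul,
    hP0, sub_zero] at hFTC
  rw [eq_sub_iff_add_eq, hFTC]

/-- **The head integral** `∫_0^x u^{-s} e^{2πiνu} du` **of §4.13**: for `0 < σ < 1`, `x ≥ 0`,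
`ν > 0`, `2πνx < t`,
`‖∫_0^x u^{-s} e^{2πiνu} du‖ ≤ x^{1-σ}/|1-s| + (2πν/|1-s|) · 4x^{2-σ}/(t - 2πνx)`
("`= O(x^{1-σ}/t) + O((ν/t) x^{1-σ}/(ν - t/2πx))`" in the book, up to sign conventions).
[cite: Titchmarsh1986, §4.13] -/
theorem norm_integral_near_head_le {s : ℂ} (hσ0 : 0 < s.re) (hσ1 : s.re < 1) {a ν : ℝ}
    (ha : 0 ≤ a) (hν : 0 < ν) (hνa : 2 * π * ν * a < s.im) :
    ‖∫ u in (0 : ℝ)..a, (u : ℂ) ^ (-s) * Complex.exp (((2 * π * ν * u : ℝ) : ℂ) * I)‖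
      ≤ a ^ (1 - s.re) / ‖1 - s‖
        + (2 * π * ν / ‖1 - s‖) * (4 * (a ^ (2 - s.re) / (s.im - 2 * π * ν * a))) := by
  have h1s : (1 - s) ≠ 0 := by
    intro h; have := congrArg Complex.re h; simp at this; linarith
  rw [integral_cpow_neg_mul_exp_eq hσ1 ha ν]
  have hA : ‖(a : ℂ) ^ (1 - s) * Complex.exp (((2 * π * ν * a : ℝ) : ℂ) * I) / (1 - s)‖
      = a ^ (1 - s.re) / ‖1 - s‖ := by
    rw [norm_div, norm_mul, Complex.norm_exp_ofReal_mul_I, mul_one]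
    congr 1
    rcases ha.eq_or_lt with h0 | hpos
    · subst h0
      rw [Complex.ofReal_zero, Complex.zero_cpow h1s, norm_zero, Real.zero_rpow (by linarith)]
    · rw [Complex.norm_cpow_eq_rpow_re_of_pos hpos]; simp
  have hB : ‖(2 * π * ν * I / (1 - s)) *
      ∫ u in (0 : ℝ)..a, (u : ℂ) ^ (1 - s) * Complex.exp (((2 * π * ν * u : ℝ) : ℂ) * I)‖
      ≤ (2 * π * ν / ‖1 - s‖) * (4 * (a ^ (2 - s.re) / (s.im - 2 * π * ν * a))) := by
    rw [norm_mul]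
    have hc : ‖2 * π * ν * I / (1 - s)‖ = 2 * π * ν / ‖1 - s‖ := by
      rw [norm_div, norm_mul, Complex.norm_I, mul_one]
      congr 1
      rw [show (2 * π * ν : ℂ) = ((2 * π * ν : ℝ) : ℂ) by push_cast; ring, Complex.norm_real,
        Real.norm_eq_abs, abs_of_pos (by positivity)]
    rw [hc]
    exact mul_le_mul_of_nonneg_left (norm_integral_near_aux_le hσ0 hσ1 ha hν hνa) (by positivity)
  calc _ ≤ ‖(a : ℂ) ^ (1 - s) * Complex.exp (((2 * π * ν * a : ℝ) : ℂ) * I) / (1 - s)‖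
        + ‖(2 * π * ν * I / (1 - s)) *
          ∫ u in (0 : ℝ)..a, (u : ℂ) ^ (1 - s) * Complex.exp (((2 * π * ν * u : ℝ) : ℂ) * I)‖ :=
        norm_sub_le _ _
    _ ≤ _ := by rw [hA]; exact add_le_add le_rfl hB


/-! ## The complete integral: `∫_0^∞ u^{a-1} e^{-ru} du = Γ(a) r^{-a}` for `Re r > 0` -/

/-- `u ↦ e^{-cu} u^p` is integrable on `(0, ∞)` for `c > 0`, `p > -1`. [folklore] -/
theorem integrableOn_exp_neg_mul_mul_rpow {c p : ℝ} (hc : 0 < c) (hp : -1 < p) :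
    IntegrableOn (fun u : ℝ => Real.exp (-(c * u)) * u ^ p) (Ioi 0) := by
  have h1 : IntegrableOn (fun x : ℝ => Real.exp (-x) * x ^ p) (Ioi 0) := by
    have := Real.GammaIntegral_convergent (s := p + 1) (by linarith)
    simpa using this
  have h2 : IntegrableOn (fun u : ℝ => Real.exp (-(c * u)) * (c * u) ^ p) (Ioi 0) := by
    have h := integrableOn_Ioi_comp_mul_left_iff (fun x : ℝ => Real.exp (-x) * x ^ p) 0 hc
    rw [mul_zero] at h
    exact h.2 h1
  have h3 : IntegrableOn (fun u : ℝ => c ^ (-p) * (Real.exp (-(c * u)) * (c * u) ^ p)) (Ioi 0) :=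
    h2.const_mul _
  refine h3.congr_fun (fun u hu => ?_) measurableSet_Ioi
  have hu : 0 < u := hu
  show c ^ (-p) * (Real.exp (-(c * u)) * (c * u) ^ p) = Real.exp (-(c * u)) * u ^ p
  rw [Real.mul_rpow hc.le hu.le, Real.rpow_neg hc.le]
  have : c ^ p ≠ 0 := (Real.rpow_pos_of_pos hc p).ne'
  field_simp

/-- **`∫_0^∞ u^{a-1} e^{-ru} du = (1/r)^a Γ(a)` for complex `r` with `Re r > 0`** (`Re a > 0`):
the analytic continuation in `r`, by the identity theorem on the right half-plane, of Mathlib's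
`Complex.integral_cpow_mul_exp_neg_mul_Ioi` (real `r > 0`). Used in Titchmarsh §4.13 in the
limiting form "`∫_0^∞ e^{2πiνu} u^{-s} du = Γ(1-s)(2πν/i)^{s-1}`". [cite: Titchmarsh1986, §4.13] -/
theorem integral_cpow_mul_exp_neg_mul_Ioi_complex {a r : ℂ} (ha : 0 < a.re) (hr : 0 < r.re) :
    ∫ u in Ioi (0 : ℝ), (u : ℂ) ^ (a - 1) * Complex.exp (-(r * u)) = (1 / r) ^ a * Gamma a := by
  -- the two sides as functions of `r` on the right half-plane `U`
  set U : Set ℂ := {z : ℂ | 0 < z.re} with hU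
  set f : ℂ → ℂ := fun z => ∫ u in Ioi (0 : ℝ), (u : ℂ) ^ (a - 1) * Complex.exp (-(z * u)) with hf
  set g : ℂ → ℂ := fun z => (1 / z) ^ a * Gamma a with hg
  have hUo : IsOpen U := isOpen_lt continuous_const Complex.continuous_re
  have hUc : IsPreconnected U := (convex_halfSpace_re_gt 0).isPreconnected
  -- `g` is analytic on `U`
  have hg_an : AnalyticOnNhd ℂ g U := by
    apply DifferentiableOn.analyticOnNhd _ hUo
    intro z hz
    have hz0 : z ≠ 0 := fun h => by rw [h] at hz; simp [hU] at hz
    apply DifferentiableAt.differentiableWithinAt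
    apply DifferentiableAt.mul _ (differentiableAt_const _)
    apply DifferentiableAt.cpow _ (differentiableAt_const _)
    · rw [Complex.mem_slitPlane_iff]; left
      rw [one_div, Complex.inv_re]
      exact div_pos hz (Complex.normSq_pos.2 hz0)
    · exact (differentiableAt_const _).div differentiableAt_id hz0
  -- `f` is analytic on `U`: differentiate under the integral sign
  have hf_an : AnalyticOnNhd ℂ f U := by
    apply DifferentiableOn.analyticOnNhd _ hUo
    intro z₀ hz₀
    have hz₀ : 0 < z₀.re := hz₀
    set δ : ℝ := z₀.re / 2 with hδ
    have hδpos : 0 < δ := by positivity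
    set S : Set ℂ := Metric.ball z₀ δ with hS
    have hSre : ∀ z ∈ S, δ ≤ z.re := by
      intro z hz
      have h1 : |z.re - z₀.re| ≤ ‖z - z₀‖ := by
        simpa using Complex.abs_re_le_norm (z - z₀)
      have h2 : ‖z - z₀‖ < δ := mem_ball_iff_norm.1 hz
      have := (abs_lt.1 (h1.trans_lt h2)).1
      linarith
    set F : ℂ → ℝ → ℂ := fun z u => (u : ℂ) ^ (a - 1) * Complex.exp (-(z * u)) with hFdef
    set F' : ℂ → ℝ → ℂ := fun z u => (u : ℂ) ^ (a - 1) * (Complex.exp (-(z * u)) * (-(u : ℂ)))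
      with hF'def
    set bound : ℝ → ℝ := fun u => Real.exp (-(δ * u)) * u ^ a.re with hbound
    have hcont : ∀ z : ℂ, ContinuousOn (F z) (Ioi 0) := by
      intro z u hu
      have hu : 0 < u := hu
      apply ContinuousAt.continuousWithinAt
      apply ContinuousAt.mul _ (by fun_prop)
      exact Complex.continuousAt_ofReal_cpow_const u (a - 1) (Or.inr hu.ne')
    have hcont' : ∀ z : ℂ, ContinuousOn (F' z) (Ioi 0) := by
      intro z u hu
      have hu : 0 < u := hu
      apply ContinuousAt.continuousWithinAt
      apply ContinuousAt.mul _ (by fun_prop)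
      exact Complex.continuousAt_ofReal_cpow_const u (a - 1) (Or.inr hu.ne')
    have hmeas : ∀ z : ℂ, AEStronglyMeasurable (F z) (volume.restrict (Ioi 0)) := fun z =>
      (hcont z).aestronglyMeasurable measurableSet_Ioi
    -- norms on `(0, ∞)`
    have hnormF : ∀ z : ℂ, ∀ u : ℝ, 0 < u →
        ‖F z u‖ = Real.exp (-(z.re * u)) * u ^ (a.re - 1) := by
      intro z u hu
      simp only [hFdef]
      rw [norm_mul, Complex.norm_cpow_eq_rpow_re_of_pos hu, Complex.norm_exp]
      simp [mul_comm]
    have hnormF' : ∀ z : ℂ, ∀ u : ℝ, 0 < u →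
        ‖F' z u‖ = Real.exp (-(z.re * u)) * u ^ a.re := by
      intro z u hu
      simp only [hF'def]
      rw [norm_mul, norm_mul, Complex.norm_cpow_eq_rpow_re_of_pos hu, Complex.norm_exp, norm_neg,
        Complex.norm_real, Real.norm_eq_abs, abs_of_pos hu]
      rw [show a.re = (a.re - 1) + 1 by ring, Real.rpow_add hu, Real.rpow_one]
      simp; ring
    -- integrability of `F z₀`
    have hint : Integrable (F z₀) (volume.restrict (Ioi 0)) := by
      refine Integrable.mono' (integrableOn_exp_neg_mul_mul_rpow hz₀ (by linarith : -1 < a.re - 1))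
        (hmeas z₀) ?_
      refine (ae_restrict_iff' measurableSet_Ioi).2 (Filter.Eventually.of_forall fun u hu => ?_)
      rw [hnormF z₀ u hu]
    -- the derivative bound
    have hbd : ∀ᵐ u ∂(volume.restrict (Ioi (0 : ℝ))), ∀ z ∈ S, ‖F' z u‖ ≤ bound u := by
      refine (ae_restrict_iff' measurableSet_Ioi).2 (Filter.Eventually.of_forall fun u hu => ?_)
      intro z hz
      have hu : 0 < u := hu
      rw [hnormF' z u hu, hbound]
      apply mul_le_mul_of_nonneg_right _ (Real.rpow_nonneg hu.le _)
      apply Real.exp_le_exp.2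
      have := mul_le_mul_of_nonneg_right (hSre z hz) hu.le
      linarith
    have hbound_int : Integrable bound (volume.restrict (Ioi 0)) :=
      integrableOn_exp_neg_mul_mul_rpow hδpos (by linarith)
    have hderiv : ∀ᵐ u ∂(volume.restrict (Ioi (0 : ℝ))), ∀ z ∈ S,
        HasDerivAt (fun z => F z u) (F' z u) z := by
      refine Filter.Eventually.of_forall fun u z _ => ?_
      simp only [hFdef, hF'def]
      apply HasDerivAt.const_mul
      have h1 : HasDerivAt (fun z : ℂ => -(z * u)) (-(u : ℂ)) z :=
        (hasDerivAt_mul_const (u : ℂ)).neg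
      exact h1.cexp
    have h := hasDerivAt_integral_of_dominated_loc_of_deriv_le (Metric.ball_mem_nhds z₀ hδpos)
      (Filter.Eventually.of_forall hmeas) hint ((hcont' z₀).aestronglyMeasurable measurableSet_Ioi)
      hbd hbound_int hderiv
    exact h.2.differentiableAt.differentiableWithinAt
  -- `f = g` on the positive reals, hence frequently near `1`
  have hfg_real : ∀ x : ℝ, 0 < x → f x = g x := by
    intro x hx
    simp only [hf, hg]
    exact Complex.integral_cpow_mul_exp_neg_mul_Ioi ha hx
  have hfreq : ∃ᶠ z in 𝓝[≠] (1 : ℂ), f z = g z := by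
    have ht : Tendsto (fun x : ℝ => (x : ℂ)) (𝓝[>] (1 : ℝ)) (𝓝[≠] (1 : ℂ)) := by
      apply tendsto_nhdsWithin_of_tendsto_nhds_of_eventually_within
      · have : Tendsto (fun x : ℝ => (x : ℂ)) (𝓝 (1 : ℝ)) (𝓝 ((1 : ℝ) : ℂ)) :=
          Complex.continuous_ofReal.continuousAt
        simpa using this.mono_left nhdsWithin_le_nhds
      · refine eventually_nhdsWithin_of_forall fun x hx => ?_
        have hx : (1 : ℝ) < x := hx
        simp only [mem_compl_iff, mem_singleton_iff, Complex.ofReal_eq_one]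
        exact ne_of_gt hx
    apply ht.frequently
    apply Filter.Eventually.frequently
    exact eventually_nhdsWithin_of_forall fun x hx => hfg_real x (lt_trans one_pos hx)
  have hEq := hf_an.eqOn_of_preconnected_of_frequently_eq hg_an hUc
    (show (1 : ℂ) ∈ U by simp [hU]) hfreq
  exact hEq hr


/-! ## The boundary value `r → -iλ`: `∫_0^N u^{-s} e^{iλu} du` versus `Γ(1-s)(-iλ)^{s-1}` -/

/-- The damped tail: for `0 < σ`, `t ≥ 0`, `ε ≥ 0`, `λ > 0`, `0 < N ≤ N'` with `λN > t`,
`‖∫_N^{N'} u^{-s} e^{-εu} e^{iλu} du‖ ≤ 4 N^{1-σ}/(λN - t)` (Lemma 4.3 with the decreasing factor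
`u^{1-σ} e^{-εu}/(λu - t) = λ^{-1} u^{-σ} (1 + t/(λu - t)) e^{-εu}`), uniformly in `ε` and `N'`.
[cite: Titchmarsh1986, §4.13 and Lemma 4.3] -/
theorem norm_integral_damped_tail_le {s : ℂ} (hσ : 0 < s.re) (ht : 0 ≤ s.im) {ε lam N N' : ℝ}
    (hε : 0 ≤ ε) (hlam : 0 < lam) (hN : 0 < N) (hNN' : N ≤ N') (hNt : s.im < lam * N) :
    ‖∫ u in N..N', (u : ℂ) ^ (-s) * Complex.exp (((lam * u : ℝ) : ℂ) * I) * (Real.exp (-(ε * u)) : ℂ)‖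
      ≤ 4 * (N ^ (1 - s.re) / (lam * N - s.im)) := by
  set σ : ℝ := s.re with hσdef
  set t : ℝ := s.im with htdef
  -- the factor `q`, its derivative, the phase
  set q : ℝ → ℝ := fun u => u ^ (1 - σ) * (Real.exp (-(ε * u)) / (lam * u - t)) with hq
  set q' : ℝ → ℝ := fun u => (1 - σ) * u ^ (1 - σ - 1) * (Real.exp (-(ε * u)) / (lam * u - t))
      + u ^ (1 - σ) * ((Real.exp (-(ε * u)) * (-ε) * (lam * u - t)
        - Real.exp (-(ε * u)) * lam) / (lam * u - t) ^ 2) with hq'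
  set F : ℝ → ℝ := fun u => lam * u + (-t) * Real.log u with hF
  set F' : ℝ → ℝ := fun u => lam + (-t) / u with hF'
  have hpos : ∀ u ∈ Icc N N', 0 < u := fun u hu => hN.trans_le hu.1
  have hden : ∀ u ∈ Icc N N', 0 < lam * u - t := by
    intro u hu
    have := mul_le_mul_of_nonneg_left hu.1 hlam.le
    linarith
  -- identify the integrand with `(q F') e^{iF}` on `[N, N']`
  have hcongr : ∫ u in N..N', (u : ℂ) ^ (-s) * Complex.exp (((lam * u : ℝ) : ℂ) * I)
        * (Real.exp (-(ε * u)) : ℂ)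
      = ∫ u in N..N', ((q u * F' u : ℝ) : ℂ) * Complex.exp ((F u : ℂ) * I) := by
    apply intervalIntegral.integral_congr
    intro u hu
    rw [uIcc_of_le hNN'] at hu
    have hu0 := hpos u hu
    have hd := hden u hu
    beta_reduce
    rw [ofReal_cpow_mul_exp_eq hu0 (-s) lam]
    have e1 : q u * F' u = u ^ (-σ) * Real.exp (-(ε * u)) := by
      simp only [hq, hF']
      have h := powQ_mul_deriv_phase (p := -σ) (lam := lam) (m := -t) hu0 (by linarith)
      rw [show -σ + 1 = 1 - σ by ring] at h
      calc u ^ (1 - σ) * (Real.exp (-(ε * u)) / (lam * u - t)) * (lam + -t / u)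
          = (u ^ (1 - σ) / (lam * u + -t) * (lam + -t / u)) * Real.exp (-(ε * u)) := by
            rw [show lam * u + -t = lam * u - t by ring]; field_simp
        _ = u ^ (-σ) * Real.exp (-(ε * u)) := by rw [h]
    rw [e1]
    simp only [hF, hσdef, htdef, neg_re, neg_im]
    push_cast
    ring_nf
  rw [hcongr]
  -- monotonicity: `q = λ⁻¹ · u^{-σ} · (1 + t/(λu - t)) · e^{-εu}`, a product of positive
  -- decreasing functions
  have hq_alt : ∀ u ∈ Icc N N', q u = lam⁻¹ * (u ^ (-σ) * ((1 + t / (lam * u - t))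
      * Real.exp (-(ε * u)))) := by
    intro u hu
    have hu0 := hpos u hu
    have hd : lam * u - t ≠ 0 := (hden u hu).ne'
    have hlam0 : lam ≠ 0 := hlam.ne'
    simp only [hq]
    rw [show (1 : ℝ) - σ = -σ + 1 by ring, Real.rpow_add hu0, Real.rpow_one]
    have e1 : 1 + t / (lam * u - t) = lam * u / (lam * u - t) := by
      field_simp; ring
    rw [e1]
    field_simp
  have hq_nonneg : ∀ u ∈ Icc N N', 0 ≤ q u := by
    intro u hu
    simp only [hq]
    exact mul_nonneg (Real.rpow_nonneg (hpos u hu).le _)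
      (div_nonneg (Real.exp_pos _).le (hden u hu).le)
  have hanti : AntitoneOn q (Icc N N') := by
    intro u hu v hv huv
    rw [hq_alt u hu, hq_alt v hv]
    have hu0 := hpos u hu
    have hdu := hden u hu
    have hdv := hden v hv
    apply mul_le_mul_of_nonneg_left _ (inv_nonneg.2 hlam.le)
    have h1 : v ^ (-σ) ≤ u ^ (-σ) := Real.rpow_le_rpow_of_nonpos hu0 huv (by linarith)
    have h2 : 1 + t / (lam * v - t) ≤ 1 + t / (lam * u - t) := by
      have := mul_le_mul_of_nonneg_left huv hlam.le
      gcongr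
    have h3 : Real.exp (-(ε * v)) ≤ Real.exp (-(ε * u)) := by
      apply Real.exp_le_exp.2
      have := mul_le_mul_of_nonneg_left huv hε
      linarith
    have hAu : 0 ≤ 1 + t / (lam * u - t) := by
      have := div_nonneg ht hdu.le; linarith
    have hAv : 0 ≤ 1 + t / (lam * v - t) := by
      have := div_nonneg ht hdv.le; linarith
    exact mul_le_mul h1 (mul_le_mul h2 h3 (Real.exp_pos _).le hAu)
      (mul_nonneg hAv (Real.exp_pos _).le) (Real.rpow_nonneg hu0.le _)
  have hM : ∀ u ∈ Icc N N', |q u| ≤ N ^ (1 - σ) / (lam * N - t) := by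
    intro u hu
    rw [abs_of_nonneg (hq_nonneg u hu)]
    have hN_mem : N ∈ Icc N N' := left_mem_Icc.2 hNN'
    refine (hanti hN_mem hu hu.1).trans ?_
    simp only [hq]
    rw [← mul_div_assoc]
    apply div_le_div_of_nonneg_right _ (hden N hN_mem).le
    have : Real.exp (-(ε * N)) ≤ 1 := Real.exp_le_one_iff.2 (by nlinarith)
    exact mul_le_of_le_one_right (Real.rpow_nonneg hN.le _) this
  -- regularity
  have hr : ∀ p : ℝ, ContinuousOn (fun u : ℝ => u ^ p) (Icc N N') := fun p u hu =>
    (Real.continuousAt_rpow_const u p (Or.inl (hpos u hu).ne')).continuousWithinAt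
  have hqc : ContinuousOn q (Icc N N') := by
    apply (hr _).mul
    apply ContinuousOn.div (by fun_prop) (by fun_prop) (fun u hu => (hden u hu).ne')
  have hFc : ContinuousOn F (Icc N N') := by
    apply ContinuousOn.add (by fun_prop)
    exact continuousOn_const.mul (Real.continuousOn_log.mono fun u hu => (hpos u hu).ne')
  have hF'c : ContinuousOn F' (Icc N N') := by
    apply ContinuousOn.add continuousOn_const
    exact continuousOn_const.div continuousOn_id fun u hu => (hpos u hu).ne'
  have hq'c : ContinuousOn q' (Icc N N') := by
    simp only [hq']
    apply ContinuousOn.add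
    · apply ((continuousOn_const.mul (hr _)).mul _)
      apply ContinuousOn.div (by fun_prop) (by fun_prop) (fun u hu => (hden u hu).ne')
    · apply (hr _).mul
      apply ContinuousOn.div (by fun_prop) (by fun_prop)
        (fun u hu => pow_ne_zero 2 (hden u hu).ne')
  have hqd : ∀ u ∈ Ioo N N', HasDerivAt q (q' u) u := by
    intro u hu
    have hu0 : u ≠ 0 := (hpos u (Ioo_subset_Icc_self hu)).ne'
    have hd : lam * u - t ≠ 0 := (hden u (Ioo_subset_Icc_self hu)).ne'
    have h1 : HasDerivAt (fun v : ℝ => v ^ (1 - σ)) ((1 - σ) * u ^ (1 - σ - 1)) u :=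
      Real.hasDerivAt_rpow_const (Or.inl hu0)
    have h2 : HasDerivAt (fun v : ℝ => Real.exp (-(ε * v))) (Real.exp (-(ε * u)) * (-ε)) u := by
      have h0 : HasDerivAt (fun v : ℝ => ε * v) ε u := by
        simpa using (hasDerivAt_id u).const_mul ε
      exact h0.neg.exp
    have h3 : HasDerivAt (fun v : ℝ => lam * v - t) lam u := by
      simpa using ((hasDerivAt_id u).const_mul lam).sub_const t
    exact h1.mul (h2.div h3 hd)
  refine norm_integral_mul_exp_I_le hNN' (F := F) (F' := F') (q := q) (q' := q')
    (M := N ^ (1 - σ) / (lam * N - t))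
    (fun u hu => hasDerivAt_phase (hpos u (Ioo_subset_Icc_self hu)).ne')
    hqd hqc (continuousOn_mul_exp_phase hqc hFc)
    ((hq'c.mono (by rw [uIcc_of_le hNN'])).intervalIntegrable) ?_ (Or.inr hanti) hM
  apply ContinuousOn.intervalIntegrable
  rw [uIcc_of_le hNN']
  exact (Complex.continuous_ofReal.comp_continuousOn (hqc.mul hF'c)).mul
    ((Complex.continuous_ofReal.comp_continuousOn hFc).mul continuousOn_const).cexp


/-- The damped integrand `u^{-s} e^{iλu} e^{-εu}` is integrable on `(0, ∞)` for `ε > 0`,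
`σ < 1`. [folklore] -/
theorem integrableOn_damped {s : ℂ} (hσ1 : s.re < 1) {ε : ℝ} (hε : 0 < ε) (lam : ℝ) :
    IntegrableOn (fun u : ℝ => (u : ℂ) ^ (-s) * Complex.exp (((lam * u : ℝ) : ℂ) * I)
      * (Real.exp (-(ε * u)) : ℂ)) (Ioi 0) := by
  have hcont : ContinuousOn (fun u : ℝ => (u : ℂ) ^ (-s) * Complex.exp (((lam * u : ℝ) : ℂ) * I)
      * (Real.exp (-(ε * u)) : ℂ)) (Ioi 0) := by
    intro u hu
    have hu : 0 < u := hu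
    apply ContinuousAt.continuousWithinAt
    apply ContinuousAt.mul (ContinuousAt.mul _ (by fun_prop)) (by fun_prop)
    exact Complex.continuousAt_ofReal_cpow_const u (-s) (Or.inr hu.ne')
  refine Integrable.mono' (integrableOn_exp_neg_mul_mul_rpow hε (by simp; linarith : -1 < -s.re))
    (hcont.aestronglyMeasurable measurableSet_Ioi) ?_
  refine (ae_restrict_iff' measurableSet_Ioi).2 (Filter.Eventually.of_forall fun u hu => ?_)
  have hu : 0 < u := hu
  rw [norm_mul, norm_mul, Complex.norm_cpow_eq_rpow_re_of_pos hu, Complex.norm_exp_ofReal_mul_I,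
    mul_one, Complex.norm_real, Real.norm_eq_abs, abs_of_pos (Real.exp_pos _), neg_re, mul_comm]

/-- The damped tail to infinity: for `ε > 0`, `‖∫_N^∞ u^{-s} e^{iλu} e^{-εu} du‖ ≤ 4N^{1-σ}/(λN - t)`.
[cite: Titchmarsh1986, §4.13 and Lemma 4.3] -/
theorem norm_integral_Ioi_damped_le {s : ℂ} (hσ0 : 0 < s.re) (hσ1 : s.re < 1) (ht : 0 ≤ s.im)
    {ε lam N : ℝ} (hε : 0 < ε) (hlam : 0 < lam) (hN : 0 < N) (hNt : s.im < lam * N) :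
    ‖∫ u in Ioi N, (u : ℂ) ^ (-s) * Complex.exp (((lam * u : ℝ) : ℂ) * I) * (Real.exp (-(ε * u)) : ℂ)‖
      ≤ 4 * (N ^ (1 - s.re) / (lam * N - s.im)) := by
  set G : ℝ → ℂ := fun u => (u : ℂ) ^ (-s) * Complex.exp (((lam * u : ℝ) : ℂ) * I)
    * (Real.exp (-(ε * u)) : ℂ) with hG
  have hint : IntegrableOn G (Ioi N) :=
    (integrableOn_damped hσ1 hε lam).mono_set (Ioi_subset_Ioi hN.le)
  have hlim : Tendsto (fun N' => ∫ u in N..N', G u) atTop (𝓝 (∫ u in Ioi N, G u)) :=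
    intervalIntegral_tendsto_integral_Ioi N hint tendsto_id
  have hbound : ∀ᶠ N' in atTop, ‖∫ u in N..N', G u‖ ≤ 4 * (N ^ (1 - s.re) / (lam * N - s.im)) := by
    filter_upwards [Filter.eventually_ge_atTop N] with N' hNN'
    exact norm_integral_damped_tail_le hσ0 ht hε.le hlam hN hNN' hNt
  exact le_of_tendsto hlim.norm hbound


/-- Removing the damping on `[0, N]`: `‖∫_0^N u^{-s} e^{iλu} (1 - e^{-εu}) du‖ ≤ ε N^{2-σ}/(2-σ)`
(`0 ≤ 1 - e^{-εu} ≤ εu`). [folklore] -/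
theorem norm_integral_undamped_sub_damped_le {s : ℂ} (hσ1 : s.re < 1) {ε lam N : ℝ} (hε : 0 ≤ ε)
    (hN : 0 ≤ N) :
    ‖(∫ u in (0 : ℝ)..N, (u : ℂ) ^ (-s) * Complex.exp (((lam * u : ℝ) : ℂ) * I))
        - ∫ u in (0 : ℝ)..N, (u : ℂ) ^ (-s) * Complex.exp (((lam * u : ℝ) : ℂ) * I)
          * (Real.exp (-(ε * u)) : ℂ)‖
      ≤ ε * (N ^ (2 - s.re) / (2 - s.re)) := by
  set G : ℝ → ℂ := fun u => (u : ℂ) ^ (-s) * Complex.exp (((lam * u : ℝ) : ℂ) * I) with hG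
  have hGi : IntervalIntegrable G volume 0 N :=
    (intervalIntegral.intervalIntegrable_cpow' (by simp; linarith)).mul_continuousOn (by fun_prop)
  have hGεi : IntervalIntegrable (fun u => G u * (Real.exp (-(ε * u)) : ℂ)) volume 0 N :=
    hGi.mul_continuousOn (by fun_prop)
  rw [← intervalIntegral.integral_sub hGi hGεi]
  have e : (fun u => G u - G u * (Real.exp (-(ε * u)) : ℂ))
      = fun u => G u * ((1 - Real.exp (-(ε * u)) : ℝ) : ℂ) := by
    funext u; push_cast; ring
  rw [e]
  have hbound : ∀ u ∈ Ioc (0 : ℝ) N, ‖G u * ((1 - Real.exp (-(ε * u)) : ℝ) : ℂ)‖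
      ≤ ε * u ^ (1 - s.re) := by
    intro u hu
    have hu : 0 < u := hu.1
    rw [norm_mul, hG]
    beta_reduce
    rw [norm_mul, Complex.norm_cpow_eq_rpow_re_of_pos hu, Complex.norm_exp_ofReal_mul_I,
      mul_one, Complex.norm_real, Real.norm_eq_abs, neg_re]
    have h1 : 0 ≤ 1 - Real.exp (-(ε * u)) := by
      have : Real.exp (-(ε * u)) ≤ 1 := Real.exp_le_one_iff.2 (by nlinarith)
      linarith
    have h2 : 1 - Real.exp (-(ε * u)) ≤ ε * u := by
      have := Real.one_sub_le_exp_neg (ε * u); linarith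
    rw [abs_of_nonneg h1]
    calc u ^ (-s.re) * (1 - Real.exp (-(ε * u))) ≤ u ^ (-s.re) * (ε * u) :=
          mul_le_mul_of_nonneg_left h2 (Real.rpow_nonneg hu.le _)
      _ = ε * u ^ (1 - s.re) := by
          rw [show (1 : ℝ) - s.re = -s.re + 1 by ring, Real.rpow_add hu, Real.rpow_one]; ring
  calc ‖∫ u in (0 : ℝ)..N, G u * ((1 - Real.exp (-(ε * u)) : ℝ) : ℂ)‖
      ≤ ∫ u in (0 : ℝ)..N, ε * u ^ (1 - s.re) := by
        apply intervalIntegral.norm_integral_le_of_norm_le hN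
          (Filter.Eventually.of_forall fun u hu => hbound u hu)
        exact (intervalIntegral.intervalIntegrable_rpow' (by linarith)).const_mul ε
    _ = ε * (N ^ (2 - s.re) / (2 - s.re)) := by
        rw [intervalIntegral.integral_const_mul, integral_rpow (Or.inl (by linarith))]
        rw [show (1 : ℝ) - s.re + 1 = 2 - s.re by ring, Real.zero_rpow (by linarith), sub_zero]

/-- **The complete integral on the imaginary axis, in finite form** (Titchmarsh §4.13:
"`∫_0^∞ e^{2πiνu} u^{-s} du = Γ(1-s)(2πν/i)^{s-1}`" together with the Lemma 4.3 estimate of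
`∫_N^∞`): for `0 < σ < 1`, `t ≥ 0`, `λ > 0`, `N > 0` with `λN > t`,
`‖∫_0^N u^{-s} e^{iλu} du - (1/(-iλ))^{1-s} Γ(1-s)‖ ≤ 4 N^{1-σ}/(λN - t)`.
Proof: regularise by `e^{-εu}`, use `integral_cpow_mul_exp_neg_mul_Ioi_complex` with
`r = ε - iλ`, the two previous lemmas, and let `ε → 0+`. [cite: Titchmarsh1986, §4.13] -/
theorem norm_integral_cpow_mul_exp_sub_Gamma_le {s : ℂ} (hσ0 : 0 < s.re) (hσ1 : s.re < 1)
    (ht : 0 ≤ s.im) {lam N : ℝ} (hlam : 0 < lam) (hN : 0 < N) (hNt : s.im < lam * N) :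
    ‖(∫ u in (0 : ℝ)..N, (u : ℂ) ^ (-s) * Complex.exp (((lam * u : ℝ) : ℂ) * I))
        - (1 / (-(lam * I))) ^ (1 - s) * Gamma (1 - s)‖
      ≤ 4 * (N ^ (1 - s.re) / (lam * N - s.im)) := by
  set G : ℝ → ℂ := fun u => (u : ℂ) ^ (-s) * Complex.exp (((lam * u : ℝ) : ℂ) * I) with hG
  set A : ℂ := ∫ u in (0 : ℝ)..N, G u with hA
  set B : ℝ := 4 * (N ^ (1 - s.re) / (lam * N - s.im)) with hB
  set c : ℝ → ℂ := fun ε => (1 / ((ε : ℂ) - lam * I)) ^ (1 - s) * Gamma (1 - s) with hc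
  have hc0 : c 0 = (1 / (-(lam * I))) ^ (1 - s) * Gamma (1 - s) := by simp [hc]
  -- the estimate for every `ε > 0`
  have hε_est : ∀ ε : ℝ, 0 < ε → ‖A - c ε‖ ≤ ε * (N ^ (2 - s.re) / (2 - s.re)) + B := by
    intro ε hε
    set Gε : ℝ → ℂ := fun u => G u * (Real.exp (-(ε * u)) : ℂ) with hGε
    -- `c ε = ∫_0^∞ Gε`
    have hr : 0 < ((ε : ℂ) - lam * I).re := by simp [hε]
    have ha : 0 < (1 - s).re := by simp; linarith
    have hE1 := integral_cpow_mul_exp_neg_mul_Ioi_complex ha hr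
    have hcε : c ε = ∫ u in Ioi (0 : ℝ), Gε u := by
      rw [hc]
      beta_reduce
      rw [← hE1]
      apply setIntegral_congr_fun measurableSet_Ioi
      intro u hu
      simp only [hGε, hG]
      rw [show (1 : ℂ) - s - 1 = -s by ring, mul_assoc]
      congr 1
      rw [Complex.ofReal_exp, ← Complex.exp_add]
      congr 1
      push_cast
      ring
    -- split `∫_0^∞ = ∫_0^N + ∫_N^∞`
    have hint : IntegrableOn Gε (Ioi 0) := integrableOn_damped hσ1 hε lam
    have hsplit : ∫ u in Ioi (0 : ℝ), Gε u = (∫ u in (0 : ℝ)..N, Gε u) + ∫ u in Ioi N, Gε u := by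
      rw [← Ioc_union_Ioi_eq_Ioi hN.le, setIntegral_union Ioc_disjoint_Ioi_same measurableSet_Ioi
        (hint.mono_set Ioc_subset_Ioi_self) (hint.mono_set (Ioi_subset_Ioi hN.le)),
        intervalIntegral.integral_of_le hN.le]
    rw [hcε, hsplit]
    calc ‖A - ((∫ u in (0 : ℝ)..N, Gε u) + ∫ u in Ioi N, Gε u)‖
        = ‖(A - ∫ u in (0 : ℝ)..N, Gε u) - ∫ u in Ioi N, Gε u‖ := by ring_nf
      _ ≤ ‖A - ∫ u in (0 : ℝ)..N, Gε u‖ + ‖∫ u in Ioi N, Gε u‖ := norm_sub_le _ _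
      _ ≤ ε * (N ^ (2 - s.re) / (2 - s.re)) + B :=
          add_le_add (norm_integral_undamped_sub_damped_le hσ1 hε.le hN.le)
            (norm_integral_Ioi_damped_le hσ0 hσ1 ht hε hlam hN hNt)
  -- let `ε → 0+`
  have hc_cont : ContinuousAt c 0 := by
    simp only [hc]
    apply ContinuousAt.mul _ continuousAt_const
    have hbase : ContinuousAt (fun ε : ℝ => 1 / ((ε : ℂ) - lam * I)) 0 := by
      apply ContinuousAt.div continuousAt_const (by fun_prop)
      simp [hlam.ne']
    have hslit : (1 / (((0 : ℝ) : ℂ) - lam * I)) ∈ slitPlane := by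
      rw [Complex.mem_slitPlane_iff]; right
      simp [hlam.ne']
    exact ContinuousAt.cpow hbase continuousAt_const hslit
  have hlim1 : Tendsto (fun ε => ‖A - c ε‖) (𝓝[>] 0) (𝓝 ‖A - c 0‖) :=
    ((continuousAt_const.sub hc_cont).norm.tendsto).mono_left nhdsWithin_le_nhds
  have hlim2 : Tendsto (fun ε : ℝ => ε * (N ^ (2 - s.re) / (2 - s.re)) + B) (𝓝[>] 0)
      (𝓝 (0 * (N ^ (2 - s.re) / (2 - s.re)) + B)) := by
    apply Tendsto.mono_left _ nhdsWithin_le_nhds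
    exact ((continuous_id.mul continuous_const).add continuous_const).tendsto 0
  rw [zero_mul, zero_add] at hlim2
  rw [← hc0]
  exact le_of_tendsto_of_tendsto hlim1 hlim2
    (eventually_nhdsWithin_of_forall fun ε hε => hε_est ε hε)

end Literature.NumberTheory.LFunctions.AFE
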